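import Literature.AlgebraicGeometry.Resolution.PointBlowupShadeCentres
import Mathlib.Data.Finsupp.Interval
import Mathlib.RingTheory.MvPolynomial.Homogeneous
import Mathlib.LinearAlgebra.Dimension.Constructions
import Mathlib.LinearAlgebra.Dimension.Finite
import Mathlib.Order.PiLex
import HarnessLib

/-!
# The Kawanoue–Matsuki first unit `(σ, μ̃)` on the point-blow-up atlas of `x^q + F(y)`:
Hasse derivatives, the transported derivative family, `E_young`, `μ_P`, `μ_{P,D}`, `μ̃`,
and the edge predicates (typing only)

`Literature/AlgebraicGeometry/Resolution/PointBlowupIFPUnit.lean` — companion of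
`PointBlowupShade.lean` (cell `pub-rosobs`, KANGAROO-ATLAS, carver g15; INVARIANTS-g15.md §70–§74).

**Sources (definitions only; nothing is asserted).**
* H. Kawanoue, *Toward resolution of singularities over a field of positive characteristic. Part I*,
  Publ. RIMS **43** (2007) 819–909 = arXiv:math/0607009 (bib `Kawanoue2007`): idealistic filtration,
  `𝔇`-saturation with its explicit generators "`𝔇(G(S)) = G({(∂_J s, a − |J|)})`" (Lemma 2.2.1.2, Hasse–Schmidt
  derivatives `∂_J`), leading algebra and the invariant `σ` (Def. 3.2.1.1), leading generator system (Definition 3.1.3.1).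
* H. Kawanoue, K. Matsuki, *Part II. Basic invariants …*, Publ. RIMS **46** (2010) 359–422 =
  arXiv:math/0612008 (bib `KawanoueMatsuki2010`): `σ` (Def. 1.1.1.1, Lemma 1.1.2.1), the power series
  expansion w.r.t. an LGS (Lemma 2.1.2.1), `ord_ℋ`, `μ_ℋ` (Def. 3.1.1.1) and `μ_ℋ(𝕀) = inf ord_ℋ(f)/a`.
* H. Kawanoue, K. Matsuki, *Resolution of singularities of an idealistic filtration in dimension 3 after
  Benito–Villamayor*, Adv. Stud. Pure Math. **70** (2016) = arXiv:1205.4556 (bib `KawanoueMatsuki2016`),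
  §4.1: "`μ̃`: It is the (normalized) weak order modulo LGS of the idealistic filtration `ℛ`, with respect to
  `E_young` … `μ_P(ℛ) = inf{μ_P(f,a) = ord(c_{f,𝕆})/a}`, `μ_{P,D}(ℛ) = inf{ord_{ξ_D}(c_{f,𝕆})/a}`,
  `μ̃ = μ_P(ℛ) − Σ_{D ⊂ E_young} μ_{P,D}(ℛ)`"; "(iii) The symbol `E_young` refers to the union of the
  exceptional divisors created after the time when the current value of `σ` first started"; "Case: The value
  of `σ` stays the same … we keep the original `ℛ` … `ℛ` is the transformation of the one in the previous
  year"; Prop. 4: "`σ ≥ σ̃` … When `σ = σ̃`, the value of the invariant `μ̃` does not increase".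

**What is typed here (the PURELY INSEPARABLE CORNER of the atlas; dictionary D15 of INVARIANTS-g15 §71).**
For `h = x^q + F(y)`, `q = p^e`, the `𝔇`-saturation `ℛ₀ = 𝔇(G((h,q)))` is generated by `(h, q)` and the
Hasse derivatives `(∂_J F, q − |J|)`, `0 < |J| < q` (`x`-derivatives of `x^q` vanish at these orders).  As
long as `σ` keeps its root value ("the corner": the only pure leading form is `(x + ℓ)^q`), the LGS is
`h` itself, every other generator is `x`-free, its constant term `c_{f,𝕆}` in the expansion w.r.t. the LGS
is `f` itself (uniqueness in Lemma 2.1.2.1), so `μ_P = min_J ord(∂_J F)~/(q − |J|)` and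
`μ_{P,D} = min_J ord_D(∂_J F)~/(q − |J|)` over the TRANSPORTED derivative family, and `ℛ_{i+1}` is the
transformation of `ℛ_i` (transport of each generator at its own level).  This file types exactly that
bookkeeping on top of `PointBlowup.chartTransform` / `translate` of `PointBlowupShade.lean`:
`hasseDeriv`, `divisorOrder`, `IFPState` (index set, transported family, `E_young`), `init`, `step`,
`muP`, `muPD`, `muTilde`, the edge predicates `MuTildeDrops/Stalls/Increases`, the corner predicate
`IsCorner` (no derivative `∂_J F`, `0<|J|<q`, is exact — by [Kawanoue2007, Lemma 3.1.2.1] the leading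
algebra is generated by its pure part, so this is `σ = (d,…,d,d−1,…)`), and `SigmaLeavesCorner`; and, in §3,
the invariant `σ` itself: the leading algebra `L(G(T))` of a finitely generated filtration at a point of
`Sing(G(T))` (there `L = k[in f_λ : (f_λ, a_λ) exact]` by the explicit form of `G(T)_a`, Lemma 2.2.1.2 (1);
`in` = `HauserPerlega2019.initialForm` of `PointBlowupShadeCentres.lean`),
its pure part `L_{p^e} ∩ F^e(G_1)` (`F^e(G_1)` = the span of the `x_i^{p^e}` over a perfect field),
`l^{pure}_{p^e} = finrank`, `σ = (d − l^{pure}_{p^e})_e` (`sigmaSeq`, bounded by Remark 1.1.1.2 (2): `lPure_le_card`),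
the fresh generators `(x^q + F, q), (∂_J F, q − |J|)` of `𝔇(G((h,q)))` at a node (`freshGenerators`,
`sigmaFresh`), the corner value `sigmaCorner`, and the lexicographic edge predicates `SigmaDrops` /
`SigmaIncreases`.
Proved: only the defining property `hasseDeriv_monomial` (Lemma 1.2.1.2 (1)(i)), `hasseDeriv_index_zero`,
and bookkeeping (`muP_of_idx_empty`, `muTilde_init`, `mem_young_step`, `young_step_subset`).  The census that goes with it (two
independent engines over the atlas families; KM Prop. 4 tested edge by edge: no increase of `σ`, no increase of
`μ̃` at constant `σ`; the shade's kangaroo edges are `μ̃`-stalls or drops) lives in the cell's CLAIMS-g15.md;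
no statement of it is asserted here.
-/

noncomputable section

namespace Literature.AlgebraicGeometry.Resolution

open MvPolynomial
open Literature.AlgebraicGeometry.Resolution.Hauser2010

namespace PointBlowup

/-! ## 1. Hasse–Schmidt derivatives and the order along a coordinate divisor -/

section Hasse

variable {σ : Type*} {K : Type*} [CommRing K]

/-- The **Hasse–Schmidt derivative** `∂_J F = ∂^{|J|}/(J! ∂y^J) F`: coefficientwise
`y^d ↦ (∏_i C(d_i, J_i)) · y^{d−J}` (the binomial product vanishes unless `J ≤ d`).  These generate the
`𝔇`-saturation: "`𝔇(G(S))` is generated by `{(∂_J s, a − |J|)}`" (Lemma 2.2.1.2);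
"`∂_{X^J}(X^I) = binom(I,J) X^{I−J}`". [cite: Kawanoue2007, Lemma 1.2.1.2 (1)(i)] -/
def hasseDeriv (J : σ →₀ ℕ) (F : MvPolynomial σ K) : MvPolynomial σ K :=
  ∑ d ∈ F.support, monomial (d - J) ((((∏ i ∈ J.support, (d i).choose (J i)) : ℕ) : K) * coeff d F)

/-- `∂_{X^J}(c·X^I) = binom(I,J)·c·X^{I−J}` (the product of binomials vanishes unless `J ≤ I`).
[cite: Kawanoue2007, Lemma 1.2.1.2 (1)(i)] -/
theorem hasseDeriv_monomial [DecidableEq σ] (J I : σ →₀ ℕ) (c : K) :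
    hasseDeriv J (monomial I c) =
      monomial (I - J) ((((∏ i ∈ J.support, (I i).choose (J i)) : ℕ) : K) * c) := by
  classical
  rcases eq_or_ne c 0 with rfl | hc
  · simp [hasseDeriv]
  · simp [hasseDeriv, support_monomial, hc]

/-- `∂_0 = id` (`binom(I,0) = 1`). [cite: Kawanoue2007, Lemma 1.2.1.2 (1)(i)] -/
theorem hasseDeriv_index_zero (F : MvPolynomial σ K) : hasseDeriv 0 F = F := by
  unfold hasseDeriv
  simp only [Finsupp.support_zero, Finset.prod_empty, Nat.cast_one, one_mul, tsub_zero]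
  exact F.as_sum.symm

/-- The **order of `G` along the divisor `{y_i = 0}`** (`ord_{ξ_D}`, the `y_i`-adic valuation of a
polynomial): the least exponent of `y_i` in a monomial of `G`; `⊤` for `G = 0`.
[cite: KawanoueMatsuki2016, §4.1 (definition of μ_{P,D})] -/
def divisorOrder (i : σ) (G : MvPolynomial σ K) : ℕ∞ :=
  G.support.inf fun d => (d i : ℕ∞)

/-- The normalised value `ord / a ∈ ℚ_{≥0} ∪ {∞}` of a generator of level `a`
("`μ_P(f,a) = ord(c_{f,𝕆})/a`"). [cite: KawanoueMatsuki2016, §4.1 (definition of μ_P)] -/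
def levelRatio (n : ℕ∞) (a : ℕ) : WithTop ℚ :=
  WithTop.map (fun m : ℕ => (m : ℚ) / a) n

end Hasse

/-! ## 2. The corner state of the IFP first unit and its transformation -/

section IFP

variable {σ : Type*} {K : Type*} [CommRing K]

/-- The **IFP corner state** at a point of the atlas: the multi-indices `J` (`0 < |J| < q`) of the
derivative family that generates `ℛ` together with `(h, q)`, the TRANSPORTED derivatives
`gen J = (∂_J F)~` (each carried at its own level `q − |J|`: "we keep the original `ℛ` … the
transformation of the one in the previous year"), and the set `young` of exceptional components through the
point created since `σ` took its current value (`E_young`).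
[cite: KawanoueMatsuki2016, §4.1 (Remark (i)–(iii) on ℛ and E_young)] -/
structure IFPState (σ : Type*) (K : Type*) [CommRing K] where
  /-- the multi-indices `J`, `0 < |J| < q`, of the carried derivative family -/
  idx : Finset (σ →₀ ℕ)
  /-- the transported Hasse derivative `(∂_J F)~` of level `q − |J|` -/
  gen : (σ →₀ ℕ) → MvPolynomial σ K
  /-- `E_young` through the point, as coordinate hyperplanes `{y_i = 0}` -/
  young : Finset σ

namespace IFPState

/-- `μ_P(ℛ) = min_J ord_P((∂_J F)~)/(q − |J|)` — in the corner the constant term `c_{f,𝕆}` of an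
`x`-free generator is the generator itself and `(h,q)` contributes `∞`.
[cite: KawanoueMatsuki2016, §4.1 (definition of μ_P)] -/
def muP (q : ℕ) (s : IFPState σ K) : WithTop ℚ :=
  s.idx.inf fun J => levelRatio (ordZero (s.gen J)) (q - J.degree)

/-- `μ_{P,D}(ℛ) = min_J ord_{ξ_D}((∂_J F)~)/(q − |J|)` for the component `D = {y_i = 0}`.
[cite: KawanoueMatsuki2016, §4.1 (definition of μ_{P,D})] -/
def muPD (q : ℕ) (s : IFPState σ K) (i : σ) : WithTop ℚ :=
  s.idx.inf fun J => levelRatio (divisorOrder i (s.gen J)) (q - J.degree)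

/-- **`μ̃ = μ_P(ℛ) − Σ_{D ⊂ E_young} μ_{P,D}(ℛ)`** (`∞` when `μ_P = ∞`; the subtracted terms are finite
whenever `μ_P` is). [cite: KawanoueMatsuki2016, §4.1 (definition of μ̃)] -/
def muTilde (q : ℕ) (s : IFPState σ K) : WithTop ℚ :=
  WithTop.map (fun m : ℚ => m - ∑ i ∈ s.young, (s.muPD q i).untopD 0) (s.muP q)

/-- `μ_P = ∞` when no derivative is carried (e.g. `F~ = 0`: the hypersurface has become nonsingular) — the
unit `(σ, ∞, 0)` of §4.1 ("`μ̃ = ∞` … the ideal of the restriction of ℛ to Supp(ℛ) is the zero ideal").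
[cite: KawanoueMatsuki2016, §4.1 (invariant s, case μ̃ = ∞)] -/
theorem muP_of_idx_empty (q : ℕ) (s : IFPState σ K) (h : s.idx = ∅) : s.muP q = ⊤ := by
  simp [muP, h]

variable [DecidableEq σ] [DecidableEq K]

/-- The derivative indices at the root: all `J` with `0 < |J| < q` and `∂_J F ≠ 0` (a finite set:
`J ≤ d` for some monomial `y^d` of `F`). [cite: Kawanoue2007, Lemma 2.2.1.2] -/
def derivIndices (q : ℕ) (F : MvPolynomial σ K) : Finset (σ →₀ ℕ) :=
  (F.support.biUnion fun d => Finset.Iic d).filter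
    fun J => 0 < J.degree ∧ J.degree < q ∧ hasseDeriv J F ≠ 0

/-- Every carried index has `0 < |J| < q`, i.e. a positive level `q − |J|`. [cite: Kawanoue2007, Lemma 2.2.1.2] -/
theorem degree_lt_of_mem_derivIndices {q : ℕ} {F : MvPolynomial σ K} {J : σ →₀ ℕ}
    (h : J ∈ derivIndices q F) : 0 < J.degree ∧ J.degree < q := by
  simp only [derivIndices, Finset.mem_filter] at h
  exact ⟨h.2.1, h.2.2.1⟩

/-- **Year 0**: `ℛ₀ = 𝔇(G((x^q + F, q)))`, carried family `J ↦ ∂_J F`, `E_young = ∅`.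
[cite: KawanoueMatsuki2016, §4.1 (Case: σ strictly less / year 0: ℛ differentially saturated, E_young = ∅)] -/
def init (q : ℕ) (F : MvPolynomial σ K) : IFPState σ K where
  idx := derivIndices q F
  gen := fun J => hasseDeriv J F
  young := ∅

/-- **Transformation** at the point `b` of the `y_j`-chart (while `σ` stays the same): each generator is
transported at its own level, `(∂_J F)~ ↦ translate b (chartTransform (q − |J|) j (∂_J F)~)`, and
`E_young` gains the new component `{y_j = 0}` and keeps the old components through the point (`b_i = 0`).
[cite: KawanoueMatsuki2016, §4.1 (Case: σ stays the same; E_young)] -/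
def step (q : ℕ) (j : σ) (b : σ → K) (s : IFPState σ K) : IFPState σ K where
  idx := s.idx
  gen := fun J => translate b (chartTransform (q - J.degree) j (s.gen J))
  young := insert j (s.young.filter fun i => b i = 0)

/-- At year 0, `μ̃ = μ_P` ("in this case, `E_young = ∅` and hence `μ̃ = μ_P(ℛ)`").
[cite: KawanoueMatsuki2016, §4.1 (Remark (i))] -/
theorem muTilde_init (q : ℕ) (F : MvPolynomial σ K) : (init q F).muTilde q = (init q F).muP q := by
  unfold muTilde
  simp only [init, Finset.sum_empty, sub_zero]
  cases (IFPState.muP q (⟨derivIndices q F, fun J => hasseDeriv J F, ∅⟩ : IFPState σ K)) <;> rfl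

/-- The exceptional divisor just created is in `E_young`. [cite: KawanoueMatsuki2016, §4.1 (Remark (iii), E_young)] -/
theorem mem_young_step (q : ℕ) (j : σ) (b : σ → K) (s : IFPState σ K) : j ∈ (s.step q j b).young := by
  simp [step]

/-- `E_young` at the new point: strict transforms of young components through the point, plus the new
divisor. [cite: KawanoueMatsuki2016, §4.1 (Remark (iii), E_young)] -/
theorem young_step_subset (q : ℕ) (j : σ) (b : σ → K) (s : IFPState σ K) :
    (s.step q j b).young ⊆ insert j s.young := by
  intro i hi
  simp only [step, Finset.mem_insert, Finset.mem_filter] at hi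
  rcases hi with rfl | ⟨h, -⟩
  · exact Finset.mem_insert_self _ _
  · exact Finset.mem_insert_of_mem h

end IFPState

/-! ### The corner predicate (`σ` at its root value) and the edge predicates of the KM layer -/

/-- **Corner**: no Hasse derivative `∂_J F`, `0 < |J| < q`, is EXACT (order equal to its level
`q − |J|`).  Since the leading algebra of a `𝔇`-saturated filtration is generated by its pure part
(Kawanoue 2007, Lemma 3.1.2.1), for cleaned `F` this says that `x^q` is the only pure leading form up to
level `q`, i.e. `σ = (d, …, d, d−1, …)` with `d = #σ + 1` — the value of `σ` at every root of the atlas.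
[cite: Kawanoue2007, Lemma 3.1.2.1 and Definition 3.2.1.1] -/
def IsCorner {σ : Type*} {K : Type*} [CommRing K] (q : ℕ) (F : MvPolynomial σ K) : Prop :=
  ∀ J : σ →₀ ℕ, 0 < J.degree → J.degree < q → ordZero (hasseDeriv J F) ≠ ((q - J.degree : ℕ) : ℕ∞)

variable [DecidableEq σ] [DecidableEq K]

/-- **`σ` leaves the corner** along the edge (chart `y_j`, point `b`): the parent residual polynomial is in
the corner and the child is not — by Prop. 4 (1) ("`σ ≥ σ̃`") this is the only way `σ` can change from
its root value; the IFP then replaces `ℛ` by its `𝔇`-saturation and resets `E_young = ∅`.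
[cite: KawanoueMatsuki2016, Proposition 4 (1) and §4.1 (Case: σ strictly less)] -/
def SigmaLeavesCorner (q : ℕ) (j : σ) (b : σ → K) (s : State σ K) : Prop :=
  IsCorner q s.F ∧ ¬ IsCorner q (PointBlowup.step q j b s).F

/-- `μ̃` **drops** along the edge (both ends in the corner). [cite: KawanoueMatsuki2016, §4.2 (modification by (σ, μ̃))] -/
def MuTildeDrops (q : ℕ) (j : σ) (b : σ → K) (t : IFPState σ K) : Prop :=
  (t.step q j b).muTilde q < t.muTilde q

/-- `μ̃` **stalls** along the edge. [cite: KawanoueMatsuki2016, §4.2 (modification by (σ, μ̃))] -/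
def MuTildeStalls (q : ℕ) (j : σ) (b : σ → K) (t : IFPState σ K) : Prop :=
  (t.step q j b).muTilde q = t.muTilde q

/-- `μ̃` **increases** along the edge — what Prop. 4 (2) excludes for the transformations of the IFP
sequence at constant `σ` ("When `σ = σ̃`, the value of the invariant `μ̃` does not increase"); the atlas
census records it as a test column (0 occurrences).  [cite: KawanoueMatsuki2016, Proposition 4 (2)] -/
def MuTildeIncreases (q : ℕ) (j : σ) (b : σ → K) (t : IFPState σ K) : Prop :=
  t.muTilde q < (t.step q j b).muTilde q

/-- The **KM edge property** tested by the census on an atlas edge whose two ends are in the corner: the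
pair does not increase, `μ̃(child) ≤ μ̃(parent)` (a predicate on the edge; Prop. 4 (2) is the published
statement that it holds for the IFP resolution sequence). [cite: KawanoueMatsuki2016, Proposition 4 (2)] -/
def EdgeRespectsProp4 (q : ℕ) (j : σ) (b : σ → K) (s : State σ K) (t : IFPState σ K) : Prop :=
  IsEquimultiplePoint q j b s → IsCorner q s.F → IsCorner q (PointBlowup.step q j b s).F →
    (t.step q j b).muTilde q ≤ t.muTilde q

end IFP

/-! ## 3. The leading algebra at a point of `Sing`, the invariant `σ`, and its fresh value at a node -/

section Sigma

open Literature.AlgebraicGeometry.Resolution.HauserPerlega2019 (initialForm)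

variable {ι : Type*} {K : Type*} [Field K]

/-- A generator `(g, a)` is **exact** at the origin when `ord₀ g = a` (its initial form
`HauserPerlega2019.initialForm g = (g mod 𝔪^{a+1})` then lives in `L(𝕀)_a`). [cite: Kawanoue2007, Definition 3.1.1.1 (1)] -/
def IsExactGen (ga : MvPolynomial ι K × ℕ) : Prop :=
  ordZero ga.1 = ((ga.2 : ℕ) : ℕ∞)

/-- The origin lies in `Sing(G(T))`: `ord₀ g ≥ a` for every generator `(g, a) ∈ T` (then every product
`∏ g_λ^{n_λ}` has order `≥ Σ n_λ a_λ`, Lemma 2.2.1.2 (1)). [cite: Kawanoue2007, Lemma 2.2.1.2 (1)] -/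
def OriginInSing (T : Finset (MvPolynomial ι K × ℕ)) : Prop :=
  ∀ ga ∈ T, ((ga.2 : ℕ) : ℕ∞) ≤ ordZero ga.1

/-- The **leading algebra** `L(G(T)) = ⊕_n L_n`, `L_n = {f̄ mod 𝔪^{n+1} : (f, n) ∈ G(T), f ∈ 𝔪^n}`, of the
idealistic filtration generated by a finite `T ⊂ R × ℤ_{>0}`, AT A POINT OF `Sing(G(T))` (hypothesis
`OriginInSing T`; the formula below is the leading algebra only there), where (by the
explicit form `G(T)_a = (∏ f_λ^{n_λ} ; Σ n_λ a_λ ≥ a)` of Lemma 2.2.1.2 (1)) a product reaches order = level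
exactly when all its factors are exact, so that `L(G(T)) = k[in(f_λ) : (f_λ, a_λ) ∈ T exact]` (dictionary
D15-3 of the cell's INVARIANTS-g15; the general definition is Definition 3.1.1.1 (1)).
[cite: Kawanoue2007, Definition 3.1.1.1 (1) and Lemma 2.2.1.2 (1)] -/
def leadingAlgebra (T : Finset (MvPolynomial ι K × ℕ)) : Subalgebra K (MvPolynomial ι K) :=
  Algebra.adjoin K {w | ∃ ga ∈ T, IsExactGen ga ∧ w = initialForm ga.1}

/-- The degree-`n` piece `L(G(T))_n ⊂ G_n = k[x]_n`. [cite: Kawanoue2007, Definition 3.1.1.1 (1)] -/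
def leadingPiece (T : Finset (MvPolynomial ι K × ℕ)) (n : ℕ) : Submodule K (MvPolynomial ι K) :=
  Subalgebra.toSubmodule (leadingAlgebra T) ⊓ homogeneousSubmodule ι K n

variable (ι K) in
/-- `F^e(G_1)`, the `p^e`-th powers of linear forms: over a perfect field (`Σ a_i x_i)^{p^e} = Σ a_i^{p^e} x_i^{p^e}`)
this is the `k`-span of the `x_i^{p^e}`; typed as that span for the exponent `n = p^e`.
[cite: Kawanoue2007, Definition 3.1.1.1 (2)] -/
def frobeniusPureForms (n : ℕ) : Submodule K (MvPolynomial ι K) :=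
  Submodule.span K (Set.range fun i : ι => (X i : MvPolynomial ι K) ^ n)

/-- The **pure part** `L(G(T))^{pure}_{p^e} = L(G(T))_{p^e} ∩ F^e(G_1)`. [cite: Kawanoue2007, Definition 3.1.1.1 (2)] -/
def purePiece (T : Finset (MvPolynomial ι K × ℕ)) (p e : ℕ) : Submodule K (MvPolynomial ι K) :=
  leadingPiece T (p ^ e) ⊓ frobeniusPureForms ι K (p ^ e)

/-- `l^{pure}_{p^e} = dim_k L(𝕀_P)^{pure}_{p^e}`. [cite: KawanoueMatsuki2010, Definition 1.1.1.1] -/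
def lPure (T : Finset (MvPolynomial ι K × ℕ)) (p e : ℕ) : ℕ :=
  Module.finrank K (purePiece T p e)

/-- **The invariant `σ(P) = (d − l^{pure}_{p^e}(P))_{e ∈ ℤ_{≥0}}`**, `d = dim W` = the number of variables.
[cite: KawanoueMatsuki2010, Definition 1.1.1.1] -/
def sigmaSeq [Fintype ι] (T : Finset (MvPolynomial ι K × ℕ)) (p : ℕ) : ℕ → ℕ :=
  fun e => Fintype.card ι - lPure T p e

/-- `0 ≤ l^{pure}_{p^e}(P) ≤ d = dim W` ("uniformly bounded from above by `d`").
[cite: KawanoueMatsuki2010, Remark 1.1.1.2 (2)] -/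
theorem lPure_le_card [Fintype ι] (T : Finset (MvPolynomial ι K × ℕ)) (p e : ℕ) :
    lPure T p e ≤ Fintype.card ι := by
  have hfin : Module.Finite K (frobeniusPureForms ι K (p ^ e)) :=
    Module.Finite.span_of_finite K (Set.finite_range _)
  calc lPure T p e ≤ Module.finrank K (frobeniusPureForms ι K (p ^ e)) :=
        Submodule.finrank_mono inf_le_right
    _ ≤ Fintype.card ι := finrank_range_le_card _

/-- `σ` is compared LEXICOGRAPHICALLY ("`σ ≥ σ̃`" in Prop. 4 (1)); `SigmaLexLt t s` : `t <_lex s`.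
[cite: KawanoueMatsuki2016, Proposition 4 (1)] -/
def SigmaLexLt (t s : ℕ → ℕ) : Prop :=
  toLex t < toLex s

end Sigma

section SigmaFresh

variable {σ : Type*} {K : Type*} [Field K] [DecidableEq σ] [DecidableEq K]

/-- The generators of the FRESH `𝔇`-saturation `𝔇(G((h, q)))` at a node, `h = x^q + F(y)`, in the variables
`Option σ` (`x = X none`, `y_i = X (some i)`): `(h, q)` and `(∂_J F, q − |J|)`, `0 < |J| < q` — by Lemma 2.2.1.2 (2)
`𝔇(G(T)) = G({(∂_{X^J} f, a − |J|)})`.  STANDING HYPOTHESES under which this finset IS the cited generating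
set: `K` of characteristic `p` and `q = p^e` (then the Hasse derivatives `∂_{x^i} x^q = binom(q,i) x^{q−i}`,
`0 < i < q`, vanish); the definition itself is stated for any field and any `q` (typing only).
[cite: Kawanoue2007, Lemma 2.2.1.2 (2)] -/
def freshGenerators (q : ℕ) (F : MvPolynomial σ K) : Finset (MvPolynomial (Option σ) K × ℕ) :=
  insert ((X none) ^ q + rename some F, q)
    ((IFPState.derivIndices q F).image fun J => (rename some (hasseDeriv J F), q - J.degree))

/-- The **fresh value of `σ`** at a node with residual polynomial `F`: `σ` of `𝔇(G((x^q + F, q)))` at the origin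
(the value the IFP takes in the year `σ` drops, and the value the census compares along every edge).
STANDING HYPOTHESES: `char K = p`, `q = p^e`, `K` perfect (so that `frobeniusPureForms` is `F^e(G_1)` and
`freshGenerators` generates the `𝔇`-saturation), and the origin in `Sing` (`OriginInSing`); outside them the
number typed here is not claimed to be the cited invariant. [cite: KawanoueMatsuki2010, Definition 1.1.1.1] -/
def sigmaFresh [Fintype σ] (p q : ℕ) (F : MvPolynomial σ K) : ℕ → ℕ :=
  sigmaSeq (freshGenerators q F) p

/-- The corner value `σ_corner = (d, …, d, d − 1, d − 1, …)` (`d` while `p^e < q`, `d − 1` from `p^e ≥ q` on):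
under the standing hypotheses of `sigmaFresh` (`char K = p`, `q = p^e`, `K` perfect) the value at every root of
the atlas, where `x^q` is the only pure leading form (cf. `IsCorner`); as a bare function it is defined for all
`d p q`. [cite: Kawanoue2007, Definition 3.2.1.1] -/
def sigmaCorner (d p q : ℕ) : ℕ → ℕ :=
  fun e => if p ^ e < q then d else d - 1

/-- **`σ` drops** (lexicographically) along the atlas edge `(j, b)` from the node with residual `F` — the event on
which the IFP restarts with the fresh `𝔇`-saturation and `E_young = ∅` ("Case: the value of `σ` is strictly less").
[cite: KawanoueMatsuki2016, Proposition 4 (1) and §4.1] -/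
def SigmaDrops [Fintype σ] (p q : ℕ) (j : σ) (b : σ → K) (s : State σ K) : Prop :=
  SigmaLexLt (sigmaFresh p q (PointBlowup.step q j b s).F) (sigmaFresh p q s.F)

/-- **`σ` increases** along the edge — excluded by Prop. 4 (1) ("`σ ≥ σ̃`") for the IFP sequence; a test column
of the census (0 occurrences). [cite: KawanoueMatsuki2016, Proposition 4 (1)] -/
def SigmaIncreases [Fintype σ] (p q : ℕ) (j : σ) (b : σ → K) (s : State σ K) : Prop :=
  SigmaLexLt (sigmaFresh p q s.F) (sigmaFresh p q (PointBlowup.step q j b s).F)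

end SigmaFresh

end PointBlowup

end Literature.AlgebraicGeometry.Resolution

end
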